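import Summits.HodgeConjecture.HodgeConjecture.Theorems.EightfoldBlochSeedsBlochSeedsGenericRegularSequenceSpread
import Literature.AlgebraicGeometry.HodgeTheory.BlochSemiregularSpread
import Literature.AlgebraicGeometry.Resolution.MarkedIdeals
import HarnessLib

/-!
# Route `EightfoldBlochSeeds`, cruxes `BlochSeedsGeneric` / `BlochSeedDiscThree` (items stmt-HodgeConjecture-18880 / 18882),
# stub `stub_pad4_carrier`: REGULAR IMMERSIONS OF CODIMENSION `p` ARE DETECTED AT THE STALKS (brick K5-e of the road to the
# named fact `kleiman1969_smoothingCycles_eightfold_codimFour` the stub is closed modulo)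

HONEST FRAMING. A `--supports` helper (scheme-level plumbing over the commutative algebra of
`EightfoldBlochSeedsBlochSeedsGenericRegularSequenceSpread`); nothing here proves the stub, (K), the crux, H2, HC_AV or HC.
No definition, no named fact (D-0026).

WHAT. The tree's `IsRegularImmersionOfCodim i p` (Görtz–Wedhorn Def. 19.19: a closed immersion whose ideal is, on an
AFFINE OPEN around each point, generated by a weakly regular sequence of length `p`) is the conclusion (K) needs for
Kleiman's smooth connected degeneracy locus; EGA IV 17.12.1 / Matsumura 14.2 deliver regular sequences in the LOCAL RINGS
`𝒪_{X,x}` (tree: `Resolution.exists_isRsopPart_fin_span_range_eq_stalkIdeal`). This file closes the gap between the two: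

* `isRegularImmersionOfCodim_of_stalks` — on a locally Noetherian `X`, a closed immersion `i : Z ⟶ X` is a regular
  immersion of codimension `p` as soon as every point `i z` has an affine neighbourhood `U` and `p` sections
  `rs ⊆ 𝓘(U)` (`𝓘 = i.ker`) whose germs form a weakly regular sequence of `𝒪_{X, i z}` generating the stalk ideal `𝓘_{i z}`
  (`Resolution.stalkIdeal`): the germs' regularity and generation spread to `Γ(X, D(g)) = Γ(X, U)_g` for some `g` with
  `i z ∈ D(g)` (`exists_isWeaklyRegular_and_map_eq_isLocalization_away`), and `𝓘(D(g)) = 𝓘(U)·Γ(X, D(g))`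
  (`Scheme.IdealSheafData.map_ideal_basicOpen`).

[cite: EGAIV4, Prop. 17.12.1] [cite: GortzWedhorn2023, Def. 19.19 and Prop. 19.20] [cite: Matsumura1987, Thm. 14.2 and §16]
-/

noncomputable section

-- single-problem summit (Problem = Summit): the mandated namespace repeats `HodgeConjecture`.
set_option linter.dupNamespace false

open CategoryTheory AlgebraicGeometry TopologicalSpace
open Literature.AlgebraicGeometry.HodgeTheory Literature.AlgebraicGeometry.Resolution

namespace Summit.HodgeConjecture.HodgeConjecture.Theorems

universe u

open RingTheory.Sequence in
/-- **Regular immersions of codimension `p` are detected at the stalks.** Let `X` be locally Noetherian and `i : Z ⟶ X` a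
closed immersion with ideal `𝓘 = i.ker`. Suppose every point `i z` has an affine open neighbourhood `U` and a list `rs` of
`p` sections of `𝓘(U)` whose germs at `i z` form a weakly regular sequence of `𝒪_{X, i z}` and generate the stalk ideal
`𝓘_{i z}`. Then `i` is a regular immersion of codimension `p` in the tree's sense (`IsRegularImmersionOfCodim`: on the
affine open `D(g) ∋ i z`, `g ∈ Γ(X, U)`, the restrictions of `rs` form a weakly regular sequence of `Γ(X, D(g))` generating
`𝓘(D(g))`). Proof: `𝒪_{X, i z}` is the localisation of `Γ(X, U)` at the prime of `i z` and `Γ(X, D(g))` its localisation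
away from `g` (`IsAffineOpen.isLocalization_stalk`, `isLocalization_basicOpen`); apply the algebra
`exists_isWeaklyRegular_and_map_eq_isLocalization_away` and `𝓘(D(g)) = 𝓘(U)·Γ(X, D(g))`.
[cite: EGAIV4, Prop. 17.12.1] [cite: GortzWedhorn2023, Def. 19.19] -/
theorem isRegularImmersionOfCodim_of_stalks {X Z : Scheme.{u}} [IsLocallyNoetherian X] (i : Z ⟶ X)
    [IsClosedImmersion i] {p : ℕ}
    (h : ∀ z : Z, ∃ (U : X.affineOpens) (hxU : i.base z ∈ (U : X.Opens)) (rs : List Γ(X, U)),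
      rs.length = p ∧ (∀ r ∈ rs, r ∈ i.ker.ideal U) ∧
      IsWeaklyRegular (X.presheaf.stalk (i.base z)) (rs.map (X.presheaf.germ U (i.base z) hxU).hom) ∧
      stalkIdeal i.ker (i.base z) ≤ (Ideal.ofList rs).map (X.presheaf.germ U (i.base z) hxU).hom) :
    IsRegularImmersionOfCodim i p := by
  refine ⟨inferInstance, fun z => ?_⟩
  obtain ⟨U, hxU, rs, hlen, hrsI, hreg, hgen⟩ := h z
  set x := i.base z with hxdef
  haveI : IsNoetherianRing Γ(X, U) := IsLocallyNoetherian.component_noetherian U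
  letI := X.presheaf.algebra_section_stalk (⟨x, hxU⟩ : (U : X.Opens))
  haveI hloc : IsLocalization.AtPrime (X.presheaf.stalk x) (U.2.primeIdealOf ⟨x, hxU⟩).asIdeal :=
    U.2.isLocalization_stalk ⟨x, hxU⟩
  have halg : algebraMap Γ(X, U) (X.presheaf.stalk x) = (X.presheaf.germ U x hxU).hom := rfl
  -- the algebra: spread regularity and generation from the stalk to `Γ(X, U)_g`
  obtain ⟨g, hgp, hg⟩ := exists_isWeaklyRegular_and_map_eq_isLocalization_away
    (U.2.primeIdealOf ⟨x, hxU⟩).asIdeal (X.presheaf.stalk x) (i.ker.ideal U) rs hrsI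
    (by rw [halg]; exact hreg)
    (by rw [halg, ← stalkIdeal_eq_map_germ i.ker U hxU]; exact hgen)
  -- `x ∈ D(g)` since `g ∉ 𝔭_x`
  have hxg : x ∈ X.basicOpen g := by
    rw [X.mem_basicOpen g x hxU]
    have := (IsLocalization.AtPrime.isUnit_to_map_iff (X.presheaf.stalk x) (U.2.primeIdealOf ⟨x, hxU⟩).asIdeal g).2 hgp
    rw [halg] at this
    exact this
  haveI : IsLocalization.Away g Γ(X, X.basicOpen g) := U.2.isLocalization_basicOpen g
  obtain ⟨hregg, hgeng⟩ := hg g dvd_rfl Γ(X, X.basicOpen g)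
  refine ⟨X.affineBasicOpen g, hxg, rs.map (algebraMap Γ(X, U) Γ(X, X.basicOpen g)), by rw [List.length_map, hlen],
    hregg, ?_⟩
  have e1 : Ideal.ofList (rs.map (algebraMap Γ(X, U) Γ(X, X.basicOpen g))) =
      (Ideal.ofList rs).map (algebraMap Γ(X, U) Γ(X, X.basicOpen g)) :=
    (Ideal.map_ofList (algebraMap Γ(X, U) Γ(X, X.basicOpen g)) rs).symm
  rw [← hgeng] at e1
  exact e1.trans (i.ker.map_ideal_basicOpen U g)

/-! ## From generators of the stalk ideals (unit scaling and lifting of germs) -/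


section UnitScaling

open scoped Pointwise

variable {R : Type*} [CommRing R]

/-- `u • N = N`-shaped fact: for a unit `u`, `(u * r) • ⊤ = r • ⊤` as submodules. [folklore] -/
theorem isUnit_mul_smul_top_eq {N : Type*} [AddCommGroup N] [Module R N] {u : R} (hu : IsUnit u) (r : R) :
    ((u * r) • ⊤ : Submodule R N) = r • ⊤ := by
  obtain ⟨v, hv⟩ := hu.exists_left_inv
  apply le_antisymm
  · rintro x hx
    obtain ⟨n, -, rfl⟩ := (Submodule.mem_smul_pointwise_iff_exists x (u * r) ⊤).1 hx
    exact (Submodule.mem_smul_pointwise_iff_exists _ r ⊤).2 ⟨u • n, Submodule.mem_top, by rw [mul_comm, mul_smul]⟩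
  · rintro x hx
    obtain ⟨n, -, rfl⟩ := (Submodule.mem_smul_pointwise_iff_exists x r ⊤).1 hx
    refine (Submodule.mem_smul_pointwise_iff_exists _ (u * r) ⊤).2 ⟨v • n, Submodule.mem_top, ?_⟩
    rw [smul_smul, show u * r * v = r by rw [mul_assoc, mul_comm r v, ← mul_assoc, mul_comm u v, hv, one_mul]]

open RingTheory.Sequence in
/-- **Weak regularity is insensitive to scaling the members by units**: if `c₀, …, c_{n-1}` is weakly `N`-regular and
`c'_j = u_j c_j` with `u_j` units, then `c'_0, …, c'_{n-1}` is weakly `N`-regular (`u_j c_j` is `N/(c'_0,…)`-regular as a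
product of regular elements, and `N ⧸ u c N = N ⧸ c N`). [cite: Matsumura1987, §16 (before Thm. 16.1)] -/
theorem isWeaklyRegular_ofFn_of_isUnit_mul :
    ∀ {n : ℕ} (c c' : Fin n → R), (∀ j, ∃ u : R, IsUnit u ∧ c' j = u * c j) →
      ∀ {N : Type*} [AddCommGroup N] [Module R N], IsWeaklyRegular N (List.ofFn c) →
        IsWeaklyRegular N (List.ofFn c') := by
  intro n
  induction n with
  | zero => intro c c' _ N _ _ _; rw [List.ofFn_zero]; exact IsWeaklyRegular.nil R N
  | succ n ih =>
    intro c c' hcc' N _ _ h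
    rw [List.ofFn_succ] at h ⊢
    obtain ⟨h1, h2⟩ := (isWeaklyRegular_cons_iff N (c 0) _).1 h
    obtain ⟨u, hu, hu'⟩ := hcc' 0
    refine (isWeaklyRegular_cons_iff N (c' 0) _).2 ⟨?_, ?_⟩
    · rw [hu']; exact (hu.isSMulRegular N).mul h1
    · have heq : ((c' 0) • ⊤ : Submodule R N) = (c 0) • ⊤ := by rw [hu']; exact isUnit_mul_smul_top_eq hu (c 0)
      let e : QuotSMulTop (c' 0) N ≃ₗ[R] QuotSMulTop (c 0) N := Submodule.quotEquivOfEq _ _ heq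
      exact (e.isWeaklyRegular_congr _).2
        (ih (fun i => c i.succ) (fun i => c' i.succ) (fun j => hcc' j.succ) h2)

end UnitScaling

open RingTheory.Sequence in
/-- **Regular immersions of codimension `p` from generators of the stalk ideals** (EGA IV 17.12.1, geometric-to-algebraic
packaging): on a locally Noetherian `X`, a closed immersion `i : Z ⟶ X` is `IsRegularImmersionOfCodim i p` as soon as at
every point `i z` the stalk ideal `𝓘_{i z}` (`Resolution.stalkIdeal i.ker`) is generated by `p` germs forming a weakly
regular sequence of `𝒪_{X, i z}` — the shape delivered by Matsumura 14.2 for smooth-in-smooth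
(`Resolution.exists_isRsopPart_fin_span_range_eq_stalkIdeal` with `IsRsopPart` ⟹ regular). The germs are written as
`a_j / s_j` with `a_j ∈ 𝓘(U)`, `s_j ∉ 𝔭` on an affine `U ∋ i z`; the `a_j` differ from the `c_j` by units of `𝒪_{X, i z}`
(`isWeaklyRegular_ofFn_of_isUnit_mul`) and generate the same stalk ideal; then `isRegularImmersionOfCodim_of_stalks`.
[cite: EGAIV4, Prop. 17.12.1] [cite: GortzWedhorn2023, Def. 19.19] [cite: Matsumura1987, Thm. 14.2 and §16] -/
theorem isRegularImmersionOfCodim_of_stalkIdeal_eq_span {X Z : Scheme.{u}} [IsLocallyNoetherian X] (i : Z ⟶ X)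
    [IsClosedImmersion i] {p : ℕ}
    (h : ∀ z : Z, ∃ c : Fin p → X.presheaf.stalk (i.base z),
      IsWeaklyRegular (X.presheaf.stalk (i.base z)) (List.ofFn c) ∧
      Ideal.span (Set.range c) = stalkIdeal i.ker (i.base z)) :
    IsRegularImmersionOfCodim i p := by
  refine isRegularImmersionOfCodim_of_stalks i fun z => ?_
  obtain ⟨c, hreg, hspan⟩ := h z
  obtain ⟨U', hU', hxU, -⟩ :=
    exists_isAffineOpen_mem_and_subset (X := X) (x := i.base z) (U := ⊤) (Opens.mem_top (i.base z))
  let U : X.affineOpens := ⟨U', hU'⟩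
  letI := X.presheaf.algebra_section_stalk (⟨i.base z, hxU⟩ : (U : X.Opens))
  haveI hloc : IsLocalization.AtPrime (X.presheaf.stalk (i.base z)) (U.2.primeIdealOf ⟨i.base z, hxU⟩).asIdeal :=
    U.2.isLocalization_stalk ⟨i.base z, hxU⟩
  have halg : algebraMap Γ(X, U) (X.presheaf.stalk (i.base z)) = (X.presheaf.germ U (i.base z) hxU).hom := rfl
  -- write `c j = a_j / s_j` with `a_j ∈ 𝓘(U)`, `s_j ∉ 𝔭`
  have hcj : ∀ j, ∃ (a : Γ(X, U)) (s : Γ(X, U)), a ∈ i.ker.ideal U ∧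
      s ∈ (U.2.primeIdealOf ⟨i.base z, hxU⟩).asIdeal.primeCompl ∧
      c j * algebraMap Γ(X, U) (X.presheaf.stalk (i.base z)) s = algebraMap Γ(X, U) (X.presheaf.stalk (i.base z)) a := by
    intro j
    have hc : c j ∈ (i.ker.ideal U).map (algebraMap Γ(X, U) (X.presheaf.stalk (i.base z))) := by
      rw [halg, ← stalkIdeal_eq_map_germ i.ker U hxU, ← hspan]
      exact Ideal.subset_span ⟨j, rfl⟩
    obtain ⟨⟨⟨a, ha⟩, ⟨s, hs⟩⟩, h⟩ :=
      (IsLocalization.mem_map_algebraMap_iff (U.2.primeIdealOf ⟨i.base z, hxU⟩).asIdeal.primeCompl (X.presheaf.stalk (i.base z))).1 hc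
    exact ⟨a, s, ha, hs, h⟩
  choose a s ha hs hcas using hcj
  have hunit : ∀ j, IsUnit (algebraMap Γ(X, U) (X.presheaf.stalk (i.base z)) (s j)) := fun j =>
    IsLocalization.map_units (X.presheaf.stalk (i.base z)) (⟨s j, hs j⟩ : (U.2.primeIdealOf ⟨i.base z, hxU⟩).asIdeal.primeCompl)
  refine ⟨U, hxU, List.ofFn a, List.length_ofFn, ?_, ?_, ?_⟩
  · intro r hr
    obtain ⟨j, rfl⟩ := (List.mem_ofFn' a r).1 hr
    exact ha j
  · -- the germs `a_j / 1 = (s_j / 1) · c_j` are unit multiples of the `c_j`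
    rw [List.map_ofFn, ← halg]
    refine isWeaklyRegular_ofFn_of_isUnit_mul c _ (fun j => ⟨algebraMap Γ(X, U) (X.presheaf.stalk (i.base z)) (s j), hunit j, ?_⟩)
      hreg
    change algebraMap Γ(X, U) (X.presheaf.stalk (i.base z)) (a j) = _
    rw [← hcas j, mul_comm]
  · -- generation: `c_j = (a_j / 1) · (s_j / 1)⁻¹ ∈ (a) · 𝒪_{X,x}`
    rw [← hspan, Ideal.span_le, ← halg]
    rintro _ ⟨j, rfl⟩
    obtain ⟨v, hv⟩ := (hunit j).exists_right_inv
    have : c j = algebraMap Γ(X, U) (X.presheaf.stalk (i.base z)) (a j) * v := by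
      rw [← hcas j, mul_assoc, hv, mul_one]
    rw [SetLike.mem_coe, this]
    exact Ideal.mul_mem_right _ _ (Ideal.mem_map_of_mem _ (Ideal.subset_span ((List.mem_ofFn' a _).2 ⟨j, rfl⟩)))

end Summit.HodgeConjecture.HodgeConjecture.Theorems

end
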